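import Summits.QuantumFields.BalabanUV.Beta.CombChartJointEndTablesAn1
import Summits.QuantumFields.BalabanUV.Beta.FP.StepKernelWardDataTables

/-!
# `BalabanUV.Beta.FP.StepKernelWardDataTablesAn1` — road «FP» for binder row D1, ROUTE T, (L4′) OF TID § F.10, OWNER #30b: **hW ∧ hR TWINS OF ROOTS `CombChartJointEndTablesParity` AND `CombChartJointEndTablesAn1` — table parity by name; an1's FIRST-ORDER tables**

WHY (road «FP», ROUTE T, TID § F.10 (L4′); OWNER #30).  The (F1) END socket #28 `FP/StepRecursionFeed` §5 concludes M‴'s `htel : D1Tel Lc (JsB12CombShSym hLc N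
(symTablesAn1S2 3 Lc cΛ) cΛ cB) Jc` from the road's rows (L1)(L2′) AND an4's side binders (L4′) `hT0 hT1` — (T0)(T1) of the step kernels of the (III′) literal of
record.  Those follow (β-lead's `ScalewiseVectorSeam.scalewiseData_of_printed_flip` at an4's uniform decay `hdec_TbalOf`) from hW ∧ hR of the flipped step kernels,
which the row-D1 OWNER's ROOT chain F′ … M‴ (`CombChartJointEndTables` … `CombChartJointEndReflTablesAn1S2N`, `CombRemainderParityAll`) proves LETTER BY LETTER —
but only INSIDE `D1Drift`-concluding roots (`CombChartWardEnd` §2 ∕ `CombChartJointEnd` §3 are letter-relative).  Files #30a–#30d re-trace that chain with the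
conclusion replaced by hW ∧ hR (one TWIN theorem per root: same letters, same body, callee ↦ callee's twin, route binders dropped), ending at the pinned literal
with M‴'s own scalars only (`Odd Lc`, `2 ≤ Lc`, `2 ≤ N`, `hΛ`, `hcB`); #30d then DISCHARGES (L4′) and re-cuts #28 §5 to (L1)(L2′).

WHAT (this file).  `wardRefl_JsB12CombShSym_of_wardTables_tableParity_reflLetters` (twin of `CombChartJointEndTablesParity`) ∕ `wardRefl_JsB12CombShSym_an1Tables_of_bordMixLetters_reflLettersRem` (twin of `CombChartJointEndTablesAn1`) — statements = the originals' letters VERBATIM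
(route binders `a ha h12 h126 hSL k hμν hNc Jc htel hc hMwin hML hrep` dropped; `hL2` dropped where it only fed the route), conclusion = hW ∧ hR; proofs = the originals' bodies.

HONEST DEPENDENCY (page 1, mandatory): continuum YM on T⁴ ⇐ BetaPertH ∧ nine spine estimates (0/9 proved); BetaPertH ⇐ (D1) ∧ (D4) ∧ CAP+tail;
G-an2-4 gates asym, D1 and NE2/3/4.  HONEST FRAMING (cell contract, verbatim): «discharging `BetaPertH` makes Bałaban's UV stability UNCONDITIONAL —
a real constructive-QFT result; it is NOT the continuum limit and NOT the Clay problem.»  ABSOLUTE RULE (cell charter, verbatim): «No internally-minted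
statement may enter as a cited fact. Every hypothesis is either kernel-proved in this package or a verbatim quotation of a PUBLISHED theorem with page
reference. The manuscript(s) under audit are NOT citable for their own disputed steps — they are the thing under adjudication; programme-internal
(2001/route/tribunal) claims are never citable.»  [folklore] composition BY NAME of landed modules (the row-D1 OWNER an2's ROOT chain F′ … M‴ and its letter
dischargers, the β-lead's `ScalewiseVectorSeam`, an4's `HessianTelescopingKKT`); no `def`, no `def … : Prop`, nothing cited, 0 sorry; nothing of Bałaban's
asserted; 0 estimates; 0∕4 row-D1 binders DISCHARGED BY THIS FILE (hW ∕ hR at the locks were already theorems INSIDE M‴'s chain — these files only EXPOSE them;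
`D1Tel` ∕ `D1Rep` stay the roads'); ROOT M‴ p325680 untouched; NOT (T-ID), NOT SDF, NOT D1, NOT BetaPertH, NOT continuum, NOT Clay.
Road «FP» OWNER, b2b-balaban-beta-d1-p3 gen 23, 2026-08-22.  No existing file touched.
-/

noncomputable section

open Finset
open scoped BigOperators
open Literature.MathematicalPhysics.QuantumFieldTheory
open Literature.MathematicalPhysics.QuantumFieldTheory.Balaban1983to89
open Literature.MathematicalPhysics.QuantumFieldTheory.Balaban1983to89.Beta
open ExpKernelCalculus (MKer VertexFamily comp tadpole shiftK)
open PolarizationSign (reflSign WardTransversal AxisReflectionCovariant)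
open KernelReflection (refK)
open ResolventReflection (bref Φ)
open AffineAveraging (box toSite)
open AveragingContoursRooted (ctr ctrOff)
open OneStepResolventKernel (Fib LocStencil)
open OneStepKernelFamily (vertexOfK TbalOf flipK)
open KernelWard (divV)
open StepJetData (mfNeg wilsonA)
open BalabanStepJetsSucc (wVH)
open BalabanStepW2 (M2Of wB2)
open WilsonBiStencil (wilsonW₂)
open WilsonVertex2Sym (wsym22)
open Summit.QuantumFields.BalabanUV.Beta.TameKernelCalculus
open Summit.QuantumFields.BalabanUV.Beta.ChartConjugation (conjV conjW)
open Summit.QuantumFields.BalabanUV.Beta.AxialDressingRooted (one_le_of_neZero)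
open Summit.QuantumFields.BalabanUV.Beta.AveragingWardRootedStencils (legInd)
open Summit.QuantumFields.BalabanUV.Beta.SymmetrisedStepJets (SymTables)
open Summit.QuantumFields.BalabanUV.Beta.SymShiftedSpread (bhKStepSh)
open Summit.QuantumFields.BalabanUV.Beta.BorderedHessian (sgnK bhK stepScale diagK)
open Summit.QuantumFields.BalabanUV.Beta.E3ContactGenerator (ctGenM)
open Summit.QuantumFields.BalabanUV.Beta.DshAn1 (Dsh linSym04At)
open Summit.QuantumFields.BalabanUV.Beta.CombChartStepJets (GcombSh JsB12CombSh0)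
open Summit.QuantumFields.BalabanUV.Beta.CombChartJointEnd (JsB12CombShSym)
open Summit.QuantumFields.BalabanUV.Beta.SpineRooted (M1Of)
open Summit.QuantumFields.BalabanUV.Beta.CombChartStepJets (decays_GcombSh SpureCombOf_eq)
open Summit.QuantumFields.BalabanUV.Beta.CombChartWardSockets (trK_GcombSh)
open Summit.QuantumFields.BalabanUV.Beta.SymmetrisedStepJetsParity (trK_SpureRecOf trK_M1Of)
open SecondOrderResponse (LocStencilFM)
open BalabanCompositeJets (LocStencil₂)
open Summit.QuantumFields.BalabanUV.Beta.SpineRecursiveParity (parityOdd_zero)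
open Summit.QuantumFields.BalabanUV.Beta.WardLocusWilsonEnd (locStencil_zero_apply)
open Summit.QuantumFields.BalabanUV.Beta.WilsonWardColourFree (hWil_wilson_TW₃_su hWil''_wilson_TW₃_su)
open Summit.QuantumFields.BalabanUV.Beta.SymAveragingHessianCounts (symVhSAt symHessFFAt symVhSAt_hV0_ctr)
open Summit.QuantumFields.BalabanUV.Beta.SymAveragingWardRootedStencils (divV_symVhSAt_eq_conjV_ctr)
open Summit.QuantumFields.BalabanUV.Beta.SymTablesAn1FirstOrder (symTablesAn1 trK_symTablesAn1_V trK_symTablesAn1_H)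
open Summit.QuantumFields.BalabanUV.Beta.FP.StepKernelWardDataTables (wardRefl_JsB12CombShSym_of_wardTables_multiplierTable_reflLetters)

namespace Summit.QuantumFields.BalabanUV.Beta.FP.StepKernelWardDataTablesAn1

variable {Lc : ℕ} [NeZero Lc]

/-- [folklore] **hW ∧ hR TWIN of `CombChartJointEndTablesParity.d1Drift_JsB12CombShSym_of_wardTables_tableParity_reflLetters_D1Tel_D1Rep`** (ROOT chain F′ … M‴ of row D1, chart (III′)): the SAME letters, the conclusion
replaced by the Ward transversality and the axis-reflection covariance of the flipped step kernels `flipK (TbalOf Lc (JsB12CombShSym …) j)`, every `j`;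
proof = the original body with its callee replaced by the callee's twin (route binders dropped). -/
theorem wardRefl_JsB12CombShSym_of_wardTables_tableParity_reflLetters (hLc : Odd Lc) (N : ℕ) (tabs : SymTables 3 Lc) (cΛ cB : ℝ)
    -- hW, first order: the (0.4) stencil Ward law of `tabs.V` ((S-V)⁰⁴)
    (hVd04 : ∀ u : Fin 4 → ℤ, divV tabs.V u = conjV (mfNeg (linSym04At (ctr 4 Lc) Lc)) (diagK (legInd (ctr 4 Lc) u)))
    -- hW, SECOND ORDER — (M-H) THE MULTIPLIER TABLES ARE THE `M1Of`-TABLES OF THE CONSTRAINT HESSIAN (replaces (c1)′, now the theorem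
    -- `LagrangeFoldComb.dM_SpureCombOf_M1Of_eq_vertexOfK_ScombOf`), the TABLE PARITIES (V-p)(H-p) (replace (Sp)(Mp)), the table letters
    (hM1 : ∀ (j : ℕ) (ρ : Fin 4) (w : Fin 4 → ℤ), tabs.M j ρ w = M1Of 3 Lc tabs.H cΛ j ρ w)
    (hVp : ∀ (κ : Fin 4) (u : Fin 4 → ℤ), trK (tabs.V κ u) = -sgnK (tabs.V κ u))
    (hHp : ∀ (μ : Fin 4) (y : Fin 4 → ℤ), trK (tabs.H μ y) = -sgnK (tabs.H μ y))
    (RW RW'' : (Fin 4 → ℤ) → Fin 4 → (Fin 4 → ℤ) → MKer 4 (Fib 3))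
    (RB RB'' : ℕ → (Fin 4 → ℤ) → Fin 4 → (Fin 4 → ℤ) → MKer 4 (Fib 3))
    (RM : ℕ → (Fin 4 → ℤ) → Fin 4 → (Fin 4 → ℤ) → MKer 4 (Fib 3))
    (hcls0 : ∃ C δ : ℝ, 0 < δ ∧ (∀ Y, LocStencil (RW Y) C δ) ∧ (∀ Y, LocStencil (RW'' Y) C δ) ∧ (∀ Y, LocStencil (RB 0 Y) C δ) ∧
      (∀ Y, LocStencil (RB'' 0 Y) C δ) ∧ (∀ y, VertexFamily (RM 0 y) Lc C δ))
    (hclsS : ∀ j : ℕ, ∃ C δ : ℝ, 0 < δ ∧ (∀ Y, LocStencil (RB (j + 1) Y) C δ) ∧ (∀ Y, LocStencil (RB'' (j + 1) Y) C δ) ∧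
      (∀ y, VertexFamily (RM (j + 1) y) Lc C δ))
    (hRWp : ∀ Y κ u, trK (RW Y κ u) = -sgnK (RW Y κ u)) (hRW''p : ∀ Y κ u, trK (RW'' Y κ u) = -sgnK (RW'' Y κ u))
    (hRBp : ∀ j Y κ u, trK (RB j Y κ u) = -sgnK (RB j Y κ u)) (hRB''p : ∀ j Y κ u, trK (RB'' j Y κ u) = -sgnK (RB'' j Y κ u))
    (hRMp : ∀ j y ρ' w, trK (RM j y ρ' w) = -sgnK (RM j y ρ' w))
    (hWil : ∀ (Y : Fin 4 → ℤ) (κ' : Fin 4) (u' : Fin 4 → ℤ),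
      (stepScale 3 Lc 0 * (Lc : ℝ) ^ (3 + 1))⁻¹ • ∑ v ∈ box (3 + 1) Lc,
          divV (fun κ u => ((Lc : ℝ) ^ 8) • wilsonW₂ 3 ((8 * (N : ℝ) ^ 2)⁻¹ • wsym22 N) κ u κ' u') ((Lc : ℤ) • Y + toSite v) =
        comp (((Lc : ℝ) ^ (3 + 1)) • wilsonA 3 κ' u') (diagK ((1 / 2 : ℝ) • ∑ v ∈ box (3 + 1) Lc, legInd (ctr (3 + 1) Lc) ((Lc : ℤ) • Y + toSite v)))
          - comp (diagK ((1 / 2 : ℝ) • ∑ v ∈ box (3 + 1) Lc, legInd (ctr (3 + 1) Lc) ((Lc : ℤ) • Y + toSite v))) (((Lc : ℝ) ^ (3 + 1)) • wilsonA 3 κ' u') + RW Y κ' u')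
    (hWil'' : ∀ (Y : Fin 4 → ℤ) (κ : Fin 4) (u : Fin 4 → ℤ),
      (stepScale 3 Lc 0 * (Lc : ℝ) ^ (3 + 1))⁻¹ • ∑ v ∈ box (3 + 1) Lc,
          divV (fun κ' u' => ((Lc : ℝ) ^ 8) • wilsonW₂ 3 ((8 * (N : ℝ) ^ 2)⁻¹ • wsym22 N) κ u κ' u') ((Lc : ℤ) • Y + toSite v) =
        comp (((Lc : ℝ) ^ (3 + 1)) • wilsonA 3 κ u) (diagK ((1 / 2 : ℝ) • ∑ v ∈ box (3 + 1) Lc, legInd (ctr (3 + 1) Lc) ((Lc : ℤ) • Y + toSite v)))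
          - comp (diagK ((1 / 2 : ℝ) • ∑ v ∈ box (3 + 1) Lc, legInd (ctr (3 + 1) Lc) ((Lc : ℤ) • Y + toSite v))) (((Lc : ℝ) ^ (3 + 1)) • wilsonA 3 κ u) + RW'' Y κ u)
    (hBord0 : ∀ (Y : Fin 4 → ℤ) (κ' : Fin 4) (u' : Fin 4 → ℤ),
      (stepScale 3 Lc 0 * (Lc : ℝ) ^ (3 + 1))⁻¹ • ∑ v ∈ box (3 + 1) Lc, divV (fun κ u => cB • tabs.vh₂S κ u κ' u') ((Lc : ℤ) • Y + toSite v) =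
        comp ((-((Lc : ℝ) ^ (3 + 1) * (1 / 2) * (Lc : ℝ) ^ (3 + 1))) • tabs.V κ' u') (diagK ((1 / 2 : ℝ) • ∑ v ∈ box (3 + 1) Lc, legInd (ctr (3 + 1) Lc) ((Lc : ℤ) • Y + toSite v)))
          - comp (diagK ((1 / 2 : ℝ) • ∑ v ∈ box (3 + 1) Lc, legInd (ctr (3 + 1) Lc) ((Lc : ℤ) • Y + toSite v))) ((-((Lc : ℝ) ^ (3 + 1) * (1 / 2) * (Lc : ℝ) ^ (3 + 1))) • tabs.V κ' u') + RB 0 Y κ' u')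
    (hBord0'' : ∀ (Y : Fin 4 → ℤ) (κ : Fin 4) (u : Fin 4 → ℤ),
      (stepScale 3 Lc 0 * (Lc : ℝ) ^ (3 + 1))⁻¹ • ∑ v ∈ box (3 + 1) Lc, divV (fun κ' u' => cB • tabs.vh₂S κ u κ' u') ((Lc : ℤ) • Y + toSite v) =
        comp ((-((Lc : ℝ) ^ (3 + 1) * (1 / 2) * (Lc : ℝ) ^ (3 + 1))) • tabs.V κ u) (diagK ((1 / 2 : ℝ) • ∑ v ∈ box (3 + 1) Lc, legInd (ctr (3 + 1) Lc) ((Lc : ℤ) • Y + toSite v)))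
          - comp (diagK ((1 / 2 : ℝ) • ∑ v ∈ box (3 + 1) Lc, legInd (ctr (3 + 1) Lc) ((Lc : ℤ) • Y + toSite v))) ((-((Lc : ℝ) ^ (3 + 1) * (1 / 2) * (Lc : ℝ) ^ (3 + 1))) • tabs.V κ u) + RB'' 0 Y κ u)
    (hBordS : ∀ (j : ℕ) (Y : Fin 4 → ℤ) (κ' : Fin 4) (u' : Fin 4 → ℤ),
      (stepScale 3 Lc (j + 1) * (Lc : ℝ) ^ (3 + 1))⁻¹ • ∑ v ∈ box (3 + 1) Lc, divV (fun κ u => (cB * wB2 3 Lc (j + 1)) • tabs.vh₂S κ u κ' u') ((Lc : ℤ) • Y + toSite v) =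
        comp (((-((Lc : ℝ) ^ (3 + 1) * (1 / 2) * (Lc : ℝ) ^ (3 + 1))) * wVH 3 Lc (j + 1)) • tabs.V κ' u') (diagK ((1 / 2 : ℝ) • ∑ v ∈ box (3 + 1) Lc, legInd (ctr (3 + 1) Lc) ((Lc : ℤ) • Y + toSite v)))
          - comp (diagK ((1 / 2 : ℝ) • ∑ v ∈ box (3 + 1) Lc, legInd (ctr (3 + 1) Lc) ((Lc : ℤ) • Y + toSite v))) (((-((Lc : ℝ) ^ (3 + 1) * (1 / 2) * (Lc : ℝ) ^ (3 + 1))) * wVH 3 Lc (j + 1)) • tabs.V κ' u') + RB (j + 1) Y κ' u')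
    (hBordS'' : ∀ (j : ℕ) (Y : Fin 4 → ℤ) (κ : Fin 4) (u : Fin 4 → ℤ),
      (stepScale 3 Lc (j + 1) * (Lc : ℝ) ^ (3 + 1))⁻¹ • ∑ v ∈ box (3 + 1) Lc, divV (fun κ' u' => (cB * wB2 3 Lc (j + 1)) • tabs.vh₂S κ u κ' u') ((Lc : ℤ) • Y + toSite v) =
        comp (((-((Lc : ℝ) ^ (3 + 1) * (1 / 2) * (Lc : ℝ) ^ (3 + 1))) * wVH 3 Lc (j + 1)) • tabs.V κ u) (diagK ((1 / 2 : ℝ) • ∑ v ∈ box (3 + 1) Lc, legInd (ctr (3 + 1) Lc) ((Lc : ℤ) • Y + toSite v)))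
          - comp (diagK ((1 / 2 : ℝ) • ∑ v ∈ box (3 + 1) Lc, legInd (ctr (3 + 1) Lc) ((Lc : ℤ) • Y + toSite v))) (((-((Lc : ℝ) ^ (3 + 1) * (1 / 2) * (Lc : ℝ) ^ (3 + 1))) * wVH 3 Lc (j + 1)) • tabs.V κ u) + RB'' (j + 1) Y κ u)
    (hM₂ : ∀ (j : ℕ) (y : Fin 4 → ℤ) (ρ' : Fin 4) (w : Fin 4 → ℤ),
      (stepScale 3 Lc j * (Lc : ℝ) ^ (3 + 1))⁻¹ • ∑ v ∈ box (3 + 1) Lc, divV (fun κ u => M2Of 3 Lc tabs.mixFF j κ u ρ' w) ((Lc : ℤ) • y + toSite v) =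
        comp (tabs.M j ρ' w) (diagK ((1 / 2 : ℝ) • ∑ v ∈ box (3 + 1) Lc, legInd (ctr (3 + 1) Lc) ((Lc : ℤ) • y + toSite v))) - comp (diagK ((1 / 2 : ℝ) • ∑ v ∈ box (3 + 1) Lc, legInd (ctr (3 + 1) Lc) ((Lc : ℤ) • y + toSite v))) (tabs.M j ρ' w) + RM j y ρ' w)
    -- hR, first order: the tables' REFLECTION letters (V-r)(V-ff0)(H-r)
    (hVfm : ∀ (α κ' : Fin 4) (u x z : Fin 4 → ℤ) (β m : Fin 4), tabs.V κ' (bref α κ' u) x z (Sum.inl β) (Sum.inr m) =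
      (reflSign α κ' • refK (Φ (d := 3) Lc α) (tabs.V κ' u + conjV (bhK (d := 3) Lc + Dsh Lc)
        ((((Lc : ℝ) ^ 4)⁻¹) • diagK (ctGenM 3 (bhK Lc + Dsh Lc) α Lc κ' u)))) x z (Sum.inl β) (Sum.inr m))
    (hVmf : ∀ (α κ' : Fin 4) (u x z : Fin 4 → ℤ) (m β : Fin 4), tabs.V κ' (bref α κ' u) x z (Sum.inr m) (Sum.inl β) =
      (reflSign α κ' • refK (Φ (d := 3) Lc α) (tabs.V κ' u + conjV (bhK (d := 3) Lc + Dsh Lc)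
        ((((Lc : ℝ) ^ 4)⁻¹) • diagK (ctGenM 3 (bhK Lc + Dsh Lc) α Lc κ' u)))) x z (Sum.inr m) (Sum.inl β))
    (hVmm : ∀ (α κ' : Fin 4) (u x z : Fin 4 → ℤ) (m m' : Fin 4), tabs.V κ' (bref α κ' u) x z (Sum.inr m) (Sum.inr m') =
      (reflSign α κ' • refK (Φ (d := 3) Lc α) (tabs.V κ' u + conjV (bhK (d := 3) Lc + Dsh Lc)
        ((((Lc : ℝ) ^ 4)⁻¹) • diagK (ctGenM 3 (bhK Lc + Dsh Lc) α Lc κ' u)))) x z (Sum.inr m) (Sum.inr m'))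
    (hV0 : ∀ (κ : Fin 4) (w x z : Fin 4 → ℤ) (β β' : Fin 4), tabs.V κ w x z (Sum.inl β) (Sum.inl β') = 0)
    (hHr : ∀ (α μ : Fin 4) (y : Fin 4 → ℤ), tabs.H μ (bref α μ y) = reflSign α μ • refK (Φ (d := 3) Lc α) (tabs.H μ y))
    -- the first-order contact coefficient, displayed
    (γ : ℕ → ℝ) (hγ : ∀ j, γ j = -((Lc : ℝ) ^ 8 / 2) * wVH 3 Lc j / (stepScale 3 Lc j * (Lc : ℝ) ^ 4))
    -- hR, second order: the reflection letter (Wr-conj-rem) of the undressed comb-chart jets with the PINNED first-order contacts, diagonal `X₂`, tadpole-null remainder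
    (x₂ : ℕ → Fin 4 → Fin 4 → (Fin 4 → ℤ) → Fin 4 → (Fin 4 → ℤ) → (Fin 4 → ℤ) → Fib 3 → ℝ)
    (hX₂ : ∀ j α μ y ν y', Loc (diagK (x₂ j α μ y ν y')))
    (Rm : ℕ → Fin 4 → Fin 4 → (Fin 4 → ℤ) → Fin 4 → (Fin 4 → ℤ) → MKer 4 (Fib 3))
    (hRmL : ∀ j α μ y ν y', Loc (Rm j α μ y ν y'))
    (hRm0 : ∀ j α μ y ν y', tadpole (GcombSh Lc j) (Rm j α μ y ν y') = 0)
    (hWrC : ∀ (j : ℕ) (α μ : Fin 4) (y : Fin 4 → ℤ) (ν : Fin 4) (y' : Fin 4 → ℤ),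
      (JsB12CombSh0 hLc N tabs cΛ cB j).W μ (bref α μ y) ν (bref α ν y') = (reflSign α μ * reflSign α ν) • refK (Φ Lc α)
        ((JsB12CombSh0 hLc N tabs cΛ cB j).W μ y ν y' +
          conjW (bhKStepSh 3 Lc (Dsh Lc) j) (vertexOfK (GcombSh Lc j) Lc (JsB12CombSh0 hLc N tabs cΛ cB j).S μ y)
            (vertexOfK (GcombSh Lc j) Lc (JsB12CombSh0 hLc N tabs cΛ cB j).S ν y')
            (vertexOfK (GcombSh Lc j) Lc (fun κ u => diagK (fun p a => γ j * ctGenM 3 (bhK Lc + Dsh Lc) α Lc κ u p a)) μ y)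
            (vertexOfK (GcombSh Lc j) Lc (fun κ u => diagK (fun p a => γ j * ctGenM 3 (bhK Lc + Dsh Lc) α Lc κ u p a)) ν y')
            (diagK (x₂ j α μ y ν y')) + Rm j α μ y ν y')) :
    (∀ j : ℕ, WardTransversal (flipK (TbalOf Lc (JsB12CombShSym hLc N tabs cΛ cB) j))) ∧
      (∀ j : ℕ, AxisReflectionCovariant (flipK (TbalOf Lc (JsB12CombShSym hLc N tabs cΛ cB) j))) :=
  wardRefl_JsB12CombShSym_of_wardTables_multiplierTable_reflLetters hLc N tabs cΛ cB hVd04 hM1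
    (fun j κ u => by
      rw [SpureCombOf_eq]
      exact trK_SpureRecOf (d := 3) tabs.hV tabs.hH (decays_GcombSh Lc) (fun j' => trK_GcombSh (d := 3) (Lc := Lc) j') hVp hHp _ _ cΛ j κ u)
    (fun j ρ w => by
      have e : tabs.M j = M1Of 3 Lc tabs.H cΛ j := funext fun ρ' => funext fun w' => hM1 j ρ' w'
      rw [e]
      exact trK_M1Of (d := 3) (Lc := Lc) hHp cΛ j ρ w)
    RW RW'' RB RB'' RM hcls0 hclsS hRWp hRW''p hRBp hRB''p hRMp hWil hWil'' hBord0 hBord0'' hBordS hBordS'' hM₂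
    hVfm hVmf hVmm hV0 hHr γ hγ x₂ hX₂ Rm hRmL hRm0 hWrC

/-- [folklore] **hW ∧ hR TWIN of `CombChartJointEndTablesAn1.d1Drift_JsB12CombShSym_an1Tables_of_bordMixLetters_reflLettersRem_D1Tel_D1Rep`** (ROOT chain F′ … M‴ of row D1, chart (III′)): the SAME letters, the conclusion
replaced by the Ward transversality and the axis-reflection covariance of the flipped step kernels `flipK (TbalOf Lc (JsB12CombShSym …) j)`, every `j`;
proof = the original body with its callee replaced by the callee's twin (route binders dropped). -/
theorem wardRefl_JsB12CombShSym_an1Tables_of_bordMixLetters_reflLettersRem (hLc : Odd Lc) {N : ℕ} (hN : 2 ≤ N) (cΛ cB : ℝ)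
    -- the two SECOND-ORDER sym tables and their structure letters (LB)(Lmix)(TB)(Tmix) — an1's TABLES-SYM steps S2b+, displayed
    (vh₂S : Fin (3 + 1) → (Fin (3 + 1) → ℤ) → Fin (3 + 1) → (Fin (3 + 1) → ℤ) → MKer (3 + 1) (Fib 3))
    (mixFF : Fin (3 + 1) → (Fin (3 + 1) → ℤ) → Fin (3 + 1) → (Fin (3 + 1) → ℤ) → MKer (3 + 1) (Fib 3))
    (hB : ∃ C δ : ℝ, 0 < δ ∧ LocStencil₂ vh₂S C δ) (hmix : ∃ C δ : ℝ, 0 < δ ∧ LocStencilFM Lc mixFF C δ)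
    (hBt : ∀ (κ : Fin (3 + 1)) (u : Fin (3 + 1) → ℤ) (κ' : Fin (3 + 1)) (u' t : Fin (3 + 1) → ℤ),
      vh₂S κ (u + (Lc : ℤ) • t) κ' (u' + (Lc : ℤ) • t) = shiftK (-((Lc : ℤ) • t)) (vh₂S κ u κ' u'))
    (hmixt : ∀ (κ : Fin (3 + 1)) (u : Fin (3 + 1) → ℤ) (μ : Fin (3 + 1)) (w t : Fin (3 + 1) → ℤ),
      mixFF κ (u + (Lc : ℤ) • t) μ (w + t) = shiftK (-((Lc : ℤ) • t)) (mixFF κ u μ w))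
    -- hW, SECOND ORDER: the second-order TABLE letters' remainders, their classes (one rate per level) and row parities
    (RB RB'' : ℕ → (Fin 4 → ℤ) → Fin 4 → (Fin 4 → ℤ) → MKer 4 (Fib 3))
    (RM : ℕ → (Fin 4 → ℤ) → Fin 4 → (Fin 4 → ℤ) → MKer 4 (Fib 3))
    (hcls0 : ∃ C δ : ℝ, 0 < δ ∧ (∀ Y, LocStencil (RB 0 Y) C δ) ∧ (∀ Y, LocStencil (RB'' 0 Y) C δ) ∧ (∀ y, VertexFamily (RM 0 y) Lc C δ))
    (hclsS : ∀ j : ℕ, ∃ C δ : ℝ, 0 < δ ∧ (∀ Y, LocStencil (RB (j + 1) Y) C δ) ∧ (∀ Y, LocStencil (RB'' (j + 1) Y) C δ) ∧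
      (∀ y, VertexFamily (RM (j + 1) y) Lc C δ))
    (hRBp : ∀ j Y κ u, trK (RB j Y κ u) = -sgnK (RB j Y κ u)) (hRB''p : ∀ j Y κ u, trK (RB'' j Y κ u) = -sgnK (RB'' j Y κ u))
    (hRMp : ∀ j y ρ' w, trK (RM j y ρ' w) = -sgnK (RM j y ρ' w))
    (hBord0 : ∀ (Y : Fin 4 → ℤ) (κ' : Fin 4) (u' : Fin 4 → ℤ),
      (stepScale 3 Lc 0 * (Lc : ℝ) ^ (3 + 1))⁻¹ • ∑ v ∈ box (3 + 1) Lc, divV (fun κ u => cB • vh₂S κ u κ' u') ((Lc : ℤ) • Y + toSite v) =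
        comp ((-((Lc : ℝ) ^ (3 + 1) * (1 / 2) * (Lc : ℝ) ^ (3 + 1))) • symVhSAt (ctr 4 Lc) 3 Lc rfl κ' u') (diagK ((1 / 2 : ℝ) • ∑ v ∈ box (3 + 1) Lc, legInd (ctr (3 + 1) Lc) ((Lc : ℤ) • Y + toSite v)))
          - comp (diagK ((1 / 2 : ℝ) • ∑ v ∈ box (3 + 1) Lc, legInd (ctr (3 + 1) Lc) ((Lc : ℤ) • Y + toSite v))) ((-((Lc : ℝ) ^ (3 + 1) * (1 / 2) * (Lc : ℝ) ^ (3 + 1))) • symVhSAt (ctr 4 Lc) 3 Lc rfl κ' u') + RB 0 Y κ' u')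
    (hBord0'' : ∀ (Y : Fin 4 → ℤ) (κ : Fin 4) (u : Fin 4 → ℤ),
      (stepScale 3 Lc 0 * (Lc : ℝ) ^ (3 + 1))⁻¹ • ∑ v ∈ box (3 + 1) Lc, divV (fun κ' u' => cB • vh₂S κ u κ' u') ((Lc : ℤ) • Y + toSite v) =
        comp ((-((Lc : ℝ) ^ (3 + 1) * (1 / 2) * (Lc : ℝ) ^ (3 + 1))) • symVhSAt (ctr 4 Lc) 3 Lc rfl κ u) (diagK ((1 / 2 : ℝ) • ∑ v ∈ box (3 + 1) Lc, legInd (ctr (3 + 1) Lc) ((Lc : ℤ) • Y + toSite v)))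
          - comp (diagK ((1 / 2 : ℝ) • ∑ v ∈ box (3 + 1) Lc, legInd (ctr (3 + 1) Lc) ((Lc : ℤ) • Y + toSite v))) ((-((Lc : ℝ) ^ (3 + 1) * (1 / 2) * (Lc : ℝ) ^ (3 + 1))) • symVhSAt (ctr 4 Lc) 3 Lc rfl κ u) + RB'' 0 Y κ u)
    (hBordS : ∀ (j : ℕ) (Y : Fin 4 → ℤ) (κ' : Fin 4) (u' : Fin 4 → ℤ),
      (stepScale 3 Lc (j + 1) * (Lc : ℝ) ^ (3 + 1))⁻¹ • ∑ v ∈ box (3 + 1) Lc, divV (fun κ u => (cB * wB2 3 Lc (j + 1)) • vh₂S κ u κ' u') ((Lc : ℤ) • Y + toSite v) =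
        comp (((-((Lc : ℝ) ^ (3 + 1) * (1 / 2) * (Lc : ℝ) ^ (3 + 1))) * wVH 3 Lc (j + 1)) • symVhSAt (ctr 4 Lc) 3 Lc rfl κ' u') (diagK ((1 / 2 : ℝ) • ∑ v ∈ box (3 + 1) Lc, legInd (ctr (3 + 1) Lc) ((Lc : ℤ) • Y + toSite v)))
          - comp (diagK ((1 / 2 : ℝ) • ∑ v ∈ box (3 + 1) Lc, legInd (ctr (3 + 1) Lc) ((Lc : ℤ) • Y + toSite v))) (((-((Lc : ℝ) ^ (3 + 1) * (1 / 2) * (Lc : ℝ) ^ (3 + 1))) * wVH 3 Lc (j + 1)) • symVhSAt (ctr 4 Lc) 3 Lc rfl κ' u') + RB (j + 1) Y κ' u')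
    (hBordS'' : ∀ (j : ℕ) (Y : Fin 4 → ℤ) (κ : Fin 4) (u : Fin 4 → ℤ),
      (stepScale 3 Lc (j + 1) * (Lc : ℝ) ^ (3 + 1))⁻¹ • ∑ v ∈ box (3 + 1) Lc, divV (fun κ' u' => (cB * wB2 3 Lc (j + 1)) • vh₂S κ u κ' u') ((Lc : ℤ) • Y + toSite v) =
        comp (((-((Lc : ℝ) ^ (3 + 1) * (1 / 2) * (Lc : ℝ) ^ (3 + 1))) * wVH 3 Lc (j + 1)) • symVhSAt (ctr 4 Lc) 3 Lc rfl κ u) (diagK ((1 / 2 : ℝ) • ∑ v ∈ box (3 + 1) Lc, legInd (ctr (3 + 1) Lc) ((Lc : ℤ) • Y + toSite v)))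
          - comp (diagK ((1 / 2 : ℝ) • ∑ v ∈ box (3 + 1) Lc, legInd (ctr (3 + 1) Lc) ((Lc : ℤ) • Y + toSite v))) (((-((Lc : ℝ) ^ (3 + 1) * (1 / 2) * (Lc : ℝ) ^ (3 + 1))) * wVH 3 Lc (j + 1)) • symVhSAt (ctr 4 Lc) 3 Lc rfl κ u) + RB'' (j + 1) Y κ u)
    (hM₂ : ∀ (j : ℕ) (y : Fin 4 → ℤ) (ρ' : Fin 4) (w : Fin 4 → ℤ),
      (stepScale 3 Lc j * (Lc : ℝ) ^ (3 + 1))⁻¹ • ∑ v ∈ box (3 + 1) Lc, divV (fun κ u => M2Of 3 Lc mixFF j κ u ρ' w) ((Lc : ℤ) • y + toSite v) =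
        comp (M1Of 3 Lc (symHessFFAt (ctr 4 Lc) Lc) cΛ j ρ' w) (diagK ((1 / 2 : ℝ) • ∑ v ∈ box (3 + 1) Lc, legInd (ctr (3 + 1) Lc) ((Lc : ℤ) • y + toSite v))) - comp (diagK ((1 / 2 : ℝ) • ∑ v ∈ box (3 + 1) Lc, legInd (ctr (3 + 1) Lc) ((Lc : ℤ) • y + toSite v))) (M1Of 3 Lc (symHessFFAt (ctr 4 Lc) Lc) cΛ j ρ' w) + RM j y ρ' w)
    -- hR, first order: the tables' REFLECTION letters (V-r)(V-ff0)(H-r)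
    (hVfm : ∀ (α κ' : Fin 4) (u x z : Fin 4 → ℤ) (β m : Fin 4), symVhSAt (ctr 4 Lc) 3 Lc rfl κ' (bref α κ' u) x z (Sum.inl β) (Sum.inr m) =
      (reflSign α κ' • refK (Φ (d := 3) Lc α) (symVhSAt (ctr 4 Lc) 3 Lc rfl κ' u + conjV (bhK (d := 3) Lc + Dsh Lc)
        ((((Lc : ℝ) ^ 4)⁻¹) • diagK (ctGenM 3 (bhK Lc + Dsh Lc) α Lc κ' u)))) x z (Sum.inl β) (Sum.inr m))
    (hVmf : ∀ (α κ' : Fin 4) (u x z : Fin 4 → ℤ) (m β : Fin 4), symVhSAt (ctr 4 Lc) 3 Lc rfl κ' (bref α κ' u) x z (Sum.inr m) (Sum.inl β) =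
      (reflSign α κ' • refK (Φ (d := 3) Lc α) (symVhSAt (ctr 4 Lc) 3 Lc rfl κ' u + conjV (bhK (d := 3) Lc + Dsh Lc)
        ((((Lc : ℝ) ^ 4)⁻¹) • diagK (ctGenM 3 (bhK Lc + Dsh Lc) α Lc κ' u)))) x z (Sum.inr m) (Sum.inl β))
    (hVmm : ∀ (α κ' : Fin 4) (u x z : Fin 4 → ℤ) (m m' : Fin 4), symVhSAt (ctr 4 Lc) 3 Lc rfl κ' (bref α κ' u) x z (Sum.inr m) (Sum.inr m') =
      (reflSign α κ' • refK (Φ (d := 3) Lc α) (symVhSAt (ctr 4 Lc) 3 Lc rfl κ' u + conjV (bhK (d := 3) Lc + Dsh Lc)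
        ((((Lc : ℝ) ^ 4)⁻¹) • diagK (ctGenM 3 (bhK Lc + Dsh Lc) α Lc κ' u)))) x z (Sum.inr m) (Sum.inr m'))
    (hHr : ∀ (α μ : Fin 4) (y : Fin 4 → ℤ), symHessFFAt (ctr 4 Lc) Lc μ (bref α μ y) = reflSign α μ • refK (Φ (d := 3) Lc α) (symHessFFAt (ctr 4 Lc) Lc μ y))
    -- the first-order contact coefficient, displayed
    (γ : ℕ → ℝ) (hγ : ∀ j, γ j = -((Lc : ℝ) ^ 8 / 2) * wVH 3 Lc j / (stepScale 3 Lc j * (Lc : ℝ) ^ 4))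
    -- hR, second order: the reflection letter (Wr-conj-rem) of the undressed comb-chart jets with the PINNED first-order contacts, diagonal `X₂`, tadpole-null remainder
    (x₂ : ℕ → Fin 4 → Fin 4 → (Fin 4 → ℤ) → Fin 4 → (Fin 4 → ℤ) → (Fin 4 → ℤ) → Fib 3 → ℝ)
    (hX₂ : ∀ j α μ y ν y', Loc (diagK (x₂ j α μ y ν y')))
    (Rm : ℕ → Fin 4 → Fin 4 → (Fin 4 → ℤ) → Fin 4 → (Fin 4 → ℤ) → MKer 4 (Fib 3))
    (hRmL : ∀ j α μ y ν y', Loc (Rm j α μ y ν y'))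
    (hRm0 : ∀ j α μ y ν y', tadpole (GcombSh Lc j) (Rm j α μ y ν y') = 0)
    (hWrC : ∀ (j : ℕ) (α μ : Fin 4) (y : Fin 4 → ℤ) (ν : Fin 4) (y' : Fin 4 → ℤ),
      (JsB12CombSh0 hLc N (symTablesAn1 3 Lc cΛ vh₂S mixFF hB hmix hBt hmixt) cΛ cB j).W μ (bref α μ y) ν (bref α ν y') = (reflSign α μ * reflSign α ν) • refK (Φ Lc α)
        ((JsB12CombSh0 hLc N (symTablesAn1 3 Lc cΛ vh₂S mixFF hB hmix hBt hmixt) cΛ cB j).W μ y ν y' +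
          conjW (bhKStepSh 3 Lc (Dsh Lc) j) (vertexOfK (GcombSh Lc j) Lc (JsB12CombSh0 hLc N (symTablesAn1 3 Lc cΛ vh₂S mixFF hB hmix hBt hmixt) cΛ cB j).S μ y)
            (vertexOfK (GcombSh Lc j) Lc (JsB12CombSh0 hLc N (symTablesAn1 3 Lc cΛ vh₂S mixFF hB hmix hBt hmixt) cΛ cB j).S ν y')
            (vertexOfK (GcombSh Lc j) Lc (fun κ u => diagK (fun p a => γ j * ctGenM 3 (bhK Lc + Dsh Lc) α Lc κ u p a)) μ y)
            (vertexOfK (GcombSh Lc j) Lc (fun κ u => diagK (fun p a => γ j * ctGenM 3 (bhK Lc + Dsh Lc) α Lc κ u p a)) ν y')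
            (diagK (x₂ j α μ y ν y')) + Rm j α μ y ν y')) :
    (∀ j : ℕ, WardTransversal (flipK (TbalOf Lc (JsB12CombShSym hLc N (symTablesAn1 3 Lc cΛ vh₂S mixFF hB hmix hBt hmixt) cΛ cB) j))) ∧
      (∀ j : ℕ, AxisReflectionCovariant (flipK (TbalOf Lc (JsB12CombShSym hLc N (symTablesAn1 3 Lc cΛ vh₂S mixFF hB hmix hBt hmixt) cΛ cB) j))) := by
  obtain ⟨C0, δ0, hδ0, hRBl, hRB''l, hRMl⟩ := hcls0
  have hC0 : 0 ≤ C0 := (hRMl 0 0 0).nonneg (Sum.inl 0)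
  exact wardRefl_JsB12CombShSym_of_wardTables_tableParity_reflLetters hLc N (symTablesAn1 3 Lc cΛ vh₂S mixFF hB hmix hBt hmixt) cΛ cB
    (divV_symVhSAt_eq_conjV_ctr (d := 3) (one_le_of_neZero Lc))
    (fun _ _ _ => rfl)
    (trK_symTablesAn1_V cΛ vh₂S mixFF hB hmix hBt hmixt)
    (trK_symTablesAn1_H cΛ vh₂S mixFF hB hmix hBt hmixt)
    0 0 RB RB'' RM
    ⟨C0, δ0, hδ0, locStencil_zero_apply hC0, locStencil_zero_apply hC0, hRBl, hRB''l, hRMl⟩ hclsS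
    (fun _ _ _ => parityOdd_zero) (fun _ _ _ => parityOdd_zero) hRBp hRB''p hRMp
    (hWil_wilson_TW₃_su hN Lc (ctrOff 4 Lc) rfl) (hWil''_wilson_TW₃_su hN Lc (ctrOff 4 Lc) rfl)
    hBord0 hBord0'' hBordS hBordS'' hM₂ hVfm hVmf hVmm (symVhSAt_hV0_ctr Lc) hHr γ hγ x₂ hX₂ Rm hRmL hRm0 hWrC

end Summit.QuantumFields.BalabanUV.Beta.FP.StepKernelWardDataTablesAn1

end
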